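import Summits.BirchSwinnertonDyer.BirchSwinnertonDyer.Theorems.ThetaPartnerAtTwoMazurTateCongruenceAtTwoROfPlusLineList
import Summits.BirchSwinnertonDyer.BirchSwinnertonDyer.Theorems.ThetaPartnerAtTwoMazurTateCongruenceAtTwoROfPlusLineAnyRank
import Summits.BirchSwinnertonDyer.BirchSwinnertonDyer.Theorems.ThetaPartnerAtTwoMazurTateCongruenceAtTwoRTraceParity
import HarnessLib

/-!
# Crux `MazurTateCongruenceAtTwoTop` (stmt-BirchSwinnertonDyer-25797 = `MazurTateCongruenceAtTwoR` 21416), line `symbol`: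
# ASSEMBLY — the crux BY NAME from the six named facts of the plus line, a habitat lemma `Δ_W < 0`, and ONE symbol-`μ`
# statement at `2` (lead prover bsd-wall-tp2-p1 g10; `--supports 25797`)

HONEST FRAMING. THEOREMS ONLY. The six Literature facts (Eichler–Shimura for the depleted optimal quotient, Faltings,
Mazur–Kenku, Hecke self-duality, Buzzard's mod-`2` multiplicity one, Serre's supersingular image), the habitat lemma `HΔ` and the
symbol-`μ` statement `Hμ` below are explicit HYPOTHESES; nothing about their truth is asserted and BSD is not proved by any of this.

WHAT. (§1) `layerCongruence_of_symbolBound` — the per-layer, pointwise form of `mazurTateCongruenceAtTwoR_of_depletedSymbolLaw`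
(`…ROfSymbolLaw`). (§2) `norm_sub_le_one_of_parity` — the parity bound is the `u = 1` symbol bound. (§3)
`parity_cusps_of_congruent_of_facts_anyRank` — (PAR2) at the odd-numerator `2`-power cusps for EVERY partner (the list/expanded
link of `…ROfPlusLineList` on top of the rank-free bridge `…ROfPlusLineAnyRank`); `mazurTateCongruence_of_facts` — the CONCLUSION
OF THE CRUX, with `u = 1`, for `W` good supersingular at `2` with `Δ_W < 0`, any partner `A` good supersingular at `2` with an
equivariant `W[2] ≃+ A[2]`, newforms, Pollack pairs, admissible `S₀`, rationals `ϖ, ϖ_A` with `μ⁎(W)`, `μ⁎(A)`, integral multiples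
`G, G_A` (trace congruence from `W[2] ≃ A[2]`, `…RTraceParity`). (§4) `mazurTateCongruenceAtTwoTop_of_facts` —
`MazurTateCongruenceAtTwoTop` (hence `MazurTateCongruenceAtTwoR`) BY NAME from: the six facts; `HΔ` («on the theta habitat
`Δ_W < 0`»: `A` CM, good supersingular at `2`, `a₂ = 0`, `W[2] ≃ A[2]`); `Hμ` («symbol `μ = 0` at `2`»: for every globally
minimal elliptic `E` good supersingular at `2` with `a₂(E) = 0`, newform `f`, Néron ratio `ϖ` (`ϖ·Ω_E = Ω⁺_f`) and admissible
`S₀`, the expanded `S₀`-depleted plus table `Ψ` attains its maximal `2`-adic size at some `x₀` with `‖2ϖΨ(x₀)‖ = 1`).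
Relative to the crux's binders the proof uses neither `¬ W.HasCM`, `W.analyticRank = 0` nor the cyclotomic variable.

References: [GreenbergVatsal2000] §1 (8), Thm. (1.4), §3 (13); [Vatsal1999] (1.6), Thm. (1.13); [Buzzard2000LevelLoweringModTwo]
Prop. 2.4; [DarmonDiamondTaylor1995] Prop. 2.11 (a); [Pollack2003] Prop. 6.18.
-/

set_option linter.dupNamespace false
set_option autoImplicit false

noncomputable section

open scoped Classical MatrixGroups ModularForm

open CongruenceSubgroup Polynomial WeierstrassCurve NumberField IsDedekindDomain
  Literature.NumberTheory.EllipticCurves Literature.NumberTheory.EllipticCurves.ModularForms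
  Literature.NumberTheory.EllipticCurves.Rank1Residual Literature.NumberTheory.EllipticCurves.GreenbergVatsal2000
  Literature.NumberTheory.EllipticCurves.Sprung2017
  Summit.BirchSwinnertonDyer.Rank1Residual.Supersingular
  Summit.BirchSwinnertonDyer.BirchSwinnertonDyer.Theorems.ThetaLayerLambdaCongruenceAtTwo

namespace Summit.BirchSwinnertonDyer.BirchSwinnertonDyer.Theorems.MazurTateCongruenceAtTwoR

/-! ## §1. The per-layer, pointwise reduction -/

section Layer

variable {N NA : ℕ} [NeZero N] [NeZero NA] (W A : WeierstrassCurve ℚ) (f : CuspForm (Gamma0 N) 2)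
  (fA : CuspForm (Gamma0 NA) 2)

/-- **Per-layer reduction (pointwise `mazurTateCongruenceAtTwoR_of_depletedSymbolLaw`).** For cusp forms `f, f_A` with Pollack
pairs at `2`, rationals `ϖ, ϖ_A`, integral multiples `ι G = 2^m ϖ ι L♭`, `ι G_A = 2^{m'} ϖ_A ι L♭_A`, curves `W, A`, a finite
set `S₀` of odd places, a unit `u` and an EVEN layer `n`: if `ϖ·Φ_W(a/2^{n+2}) − u·ϖ_A·Φ_A(a/2^{n+2})` is a `2`-adic integer
for every odd `a` (`Φ_• = eulerDepleteTableList • S₀.toList [·]⁺`), then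
`2^{m'}(2^m ϖ θ_n(f) ι E_W) − u 2^m (2^{m'} ϖ_A θ_n(f_A) ι E_A) ∈ ι((2^{m+m'+1}, ω_n)Λ)`.
[cite: GreenbergVatsal2000, §1 p. 9 (display (8)) and §3 (13)] [cite: Pollack2003, Prop. 6.18] -/
theorem layerCongruence_of_symbolBound {Lplus Lminus LplusA LminusA : IwasawaAlgebra 2}
    (hPP : IsPollackPair f 2 Lplus Lminus) (hPPA : IsPollackPair fA 2 LplusA LminusA) {ϖ ϖA : ℚ}
    {G GA : IwasawaAlgebra 2} {m m' : ℕ}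
    (hG : iwasawaToPowerSeries 2 G =
      PowerSeries.C ((2 : ℚ_[2]) ^ m * (ϖ : ℚ_[2])) * iwasawaToPowerSeries 2 (kobayashiL 1 Lplus Lminus))
    (hGA : iwasawaToPowerSeries 2 GA =
      PowerSeries.C ((2 : ℚ_[2]) ^ m' * (ϖA : ℚ_[2])) * iwasawaToPowerSeries 2 (kobayashiL 1 LplusA LminusA))
    (S₀ : Finset (HeightOneSpectrum (𝓞 ℚ))) (hS2 : ∀ v ∈ S₀, ((2 : ℕ) : 𝓞 ℚ) ∉ v.asIdeal) (u : ℤ_[2]ˣ) {n : ℕ}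
    (hn : Even n)
    (hu : ∀ a : ℕ, Odd a →
      ‖((ϖ * eulerDepleteTableList W S₀.toList (ratPlusSymbol f) ((a : ℚ) / (2 : ℚ) ^ (n + 2)) : ℚ) : ℚ_[2]) -
          ((u : ℤ_[2]) : ℚ_[2]) *
            ((ϖA * eulerDepleteTableList A S₀.toList (ratPlusSymbol fA) ((a : ℚ) / (2 : ℚ) ^ (n + 2)) : ℚ) : ℚ_[2])‖ ≤ 1) :
    ∃ q r : IwasawaAlgebra 2,
      PowerSeries.C (((2 : ℤ_[2]) ^ m' : ℤ_[2]) : ℚ_[2]) *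
            (PowerSeries.C ((2 : ℚ_[2]) ^ m * (ϖ : ℚ_[2])) *
              ((mazurTateElement f 2 n).map (algebraMap ℚ ℚ_[2]) : PowerSeries ℚ_[2]) *
              iwasawaToPowerSeries 2 (eulerFactorProductInv W 2 S₀)) -
          PowerSeries.C (((u : ℤ_[2]) * (2 : ℤ_[2]) ^ m : ℤ_[2]) : ℚ_[2]) *
            (PowerSeries.C ((2 : ℚ_[2]) ^ m' * (ϖA : ℚ_[2])) *
              ((mazurTateElement fA 2 n).map (algebraMap ℚ ℚ_[2]) : PowerSeries ℚ_[2]) *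
              iwasawaToPowerSeries 2 (eulerFactorProductInv A 2 S₀)) =
        iwasawaToPowerSeries 2 (PowerSeries.C ((2 : ℤ_[2]) ^ (m + m' + 1)) * q + Sprung2017.toIwasawa 2 (cyclotomicOmega 2 n) * r) := by
  obtain ⟨Y, Z, ρ, H, hLY, hYZ, hZmap⟩ := exists_layer_decomposition W A f fA hPP hPPA hG hGA S₀ hS2 u hn
  set ωZ : ℤ_[2][X] := (cyclotomicOmega 2 n).map (Int.castRingHom ℤ_[2]) with hωZ
  -- (SP2) at the sample points `5^s/2^{n+2}`: the coefficients of `Δ_n` are `2`-adic integers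
  have hδ : ∀ s : ZMod (2 ^ n),
      ‖((ϖ * eulerDepleteTableList W S₀.toList (ratPlusSymbol f) ((((cyclotomicGenerator 2 : ZMod (2 ^ (n + 2))) ^ s.val).val : ℚ) / (2 : ℚ) ^ (n + 2)) : ℚ) : ℚ_[2]) -
          ((u : ℤ_[2]) : ℚ_[2]) *
            ((ϖA * eulerDepleteTableList A S₀.toList (ratPlusSymbol fA) ((((cyclotomicGenerator 2 : ZMod (2 ^ (n + 2))) ^ s.val).val : ℚ) / (2 : ℚ) ^ (n + 2)) : ℚ) : ℚ_[2])‖ ≤ 1 :=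
    fun s ↦ hu _ (Summit.BirchSwinnertonDyer.Rank1Residual.F1Sign2.odd_val_cyclotomicGenerator_pow n s.val)
  set δ : ZMod (2 ^ n) → ℤ_[2] := fun s ↦ ⟨_, hδ s⟩ with hδdef
  set Δt : ℤ_[2][X] := ∑ s : ZMod (2 ^ n), C (δ s) * (X + 1) ^ s.val with hΔt
  have hΔ : Δt.map (algebraMap ℤ_[2] ℚ_[2]) =
      ∑ s : ZMod (2 ^ n), C (((ϖ * eulerDepleteTableList W S₀.toList (ratPlusSymbol f) ((((cyclotomicGenerator 2 : ZMod (2 ^ (n + 2))) ^ s.val).val : ℚ) / (2 : ℚ) ^ (n + 2)) : ℚ) : ℚ_[2]) -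
        ((u : ℤ_[2]) : ℚ_[2]) *
          ((ϖA * eulerDepleteTableList A S₀.toList (ratPlusSymbol fA) ((((cyclotomicGenerator 2 : ZMod (2 ^ (n + 2))) ^ s.val).val : ℚ) / (2 : ℚ) ^ (n + 2)) : ℚ) : ℚ_[2])) *
        (X + 1 : ℚ_[2][X]) ^ s.val := by
    rw [hΔt, Polynomial.map_sum]
    refine Finset.sum_congr rfl fun s _ ↦ ?_
    rw [Polynomial.map_mul, Polynomial.map_pow, Polynomial.map_add, Polynomial.map_X, Polynomial.map_one,
      Polynomial.map_C]
    rfl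
  -- division by the monic `ω_n` descends to `ℤ₂[X]`
  have hdvd : ωZ ∣ Z - C ((2 : ℤ_[2]) * (2 : ℤ_[2]) ^ m * (2 : ℤ_[2]) ^ m') * Δt := by
    rw [← Polynomial.map_dvd_map (algebraMap ℤ_[2] ℚ_[2]) Subtype.coe_injective ((monic_cyclotomicOmega 2 n).map _),
      Polynomial.map_sub, Polynomial.map_mul, Polynomial.map_C, hZmap, hΔ]
    simp only [map_mul, map_pow, map_ofNat]
    exact ⟨H, by ring⟩
  obtain ⟨Ht, hHt⟩ := hdvd
  -- assembly in `Λ`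
  refine ⟨(Δt : PowerSeries ℤ_[2]), (Ht : PowerSeries ℤ_[2]) + ρ, ?_⟩
  rw [toIwasawa_eq_coe_map, hLY]
  congr 1
  have hZΛ := congrArg (fun P : ℤ_[2][X] ↦ (P : PowerSeries ℤ_[2])) hHt
  simp only [Polynomial.coe_sub, Polynomial.coe_mul, Polynomial.coe_C] at hZΛ
  simp only [map_mul, map_pow] at hZΛ
  rw [hYZ]
  simp only [map_mul, map_pow, pow_add, pow_one]
  linear_combination hZΛ

end Layer

/-! ## §2. The parity bound is the `u = 1` symbol bound -/

/-- `‖2ϖx − 2ϖ_Ay‖₂ ≤ ‖2‖₂ ⇒ ‖ϖx − 1·ϖ_Ay‖₂ ≤ 1` (divide by the non-zero `2`). [folklore] -/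
theorem norm_sub_le_one_of_parity (ϖ ϖA x y : ℚ)
    (h : ‖((2 * ϖ * x : ℚ) : ℚ_[2]) - ((2 * ϖA * y : ℚ) : ℚ_[2])‖ ≤ ‖(2 : ℚ_[2])‖) :
    ‖((ϖ * x : ℚ) : ℚ_[2]) - (((1 : ℤ_[2]ˣ) : ℤ_[2]) : ℚ_[2]) * ((ϖA * y : ℚ) : ℚ_[2])‖ ≤ 1 := by
  rw [Units.val_one, PadicInt.coe_one, one_mul]
  have h2 : (0 : ℝ) < ‖(2 : ℚ_[2])‖ := norm_pos_iff.mpr two_ne_zero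
  have h' : ‖(2 : ℚ_[2])‖ * ‖((ϖ * x : ℚ) : ℚ_[2]) - ((ϖA * y : ℚ) : ℚ_[2])‖ ≤ ‖(2 : ℚ_[2])‖ := by
    rw [← norm_mul, mul_sub]
    convert h using 2
    push_cast
    ring
  exact (mul_le_iff_le_one_right h2).mp h'

/-! ## §3. (PAR2) at the cusps for every partner; the crux's conclusion from the six facts and `μ⁎(W)`, `μ⁎(A)` -/

section Cusps

variable {W : WeierstrassCurve ℚ} [W.IsElliptic] [W.IsGloballyMinimal] [NeZero (W.conductorNorm ℤ)]
  {A : WeierstrassCurve ℚ} [A.IsElliptic] [A.IsGloballyMinimal] [NeZero (A.conductorNorm ℤ)]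
  {f : CuspForm (Gamma0 (W.conductorNorm ℤ)) 2} {fA : CuspForm (Gamma0 (A.conductorNorm ℤ)) 2}

/-- **(PAR2) at the cusps from print + `μ`**: for `W` on the habitat⁺ (good supersingular at `2`, `Δ_W < 0`, newform `f`),
a `2`-congruent partner `A` good at `2` (newform `f_A`; ANY analytic ranks; trace congruence `hcong`), an admissible
`S₀`, and `ϖ, ϖ_A ∈ ℚ` whose doubled expanded tables take a unit value at a point of maximal `|Ψ|`: the doubled LIST tables agree
mod `2` at every odd-numerator `2`-power cusp — `‖2ϖΦ^l_W(a/2^{n+2}) − 2ϖ_AΦ^l_A(a/2^{n+2})‖₂ ≤ ‖2‖₂`, `l = S₀.toList`, i.e. the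
conclusion of (PAR2) (`…ROfSymbolParity`) for this pair — GRANTED the six named facts of the plus line (Eichler–Shimura, Faltings,
Mazur–Kenku, self-duality, Buzzard, Serre). [cite: Buzzard2000LevelLoweringModTwo, Prop. 2.4] [cite: GreenbergVatsal2000, Thm. (1.4), §3 (13)] -/
theorem parity_cusps_of_congruent_of_facts_anyRank
    (hES : eichlerShimura_depletedOptimalQuotient_periodLattice_of_dvd)
    (hF : WeierstrassCurve.isIsogenous_iff_frobeniusTrace_eq) (hMK : mazurKenku_exists_cyclic_isogeny)
    (hSD : heckeSelfDual_torsionBy_J0) (hBz : buzzard2000_multiplicityOne_gamma0)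
    (hSe : serre1972_supersingular_decompositionSubgroup_image)
    (hss : Literature.NumberTheory.EllipticCurves.Rank1Residual.GoodSS W 2) (hΔ : W.Δ < 0) (hf : IsNewformOf W f)
    (hssA : Literature.NumberTheory.EllipticCurves.Rank1Residual.GoodSS A 2) (hfA : IsNewformOf A fA)
    (hcong : ∀ q : ℕ, q.Prime → ¬ q ∣ W.conductorNorm ℤ → ¬ q ∣ A.conductorNorm ℤ →
      ‖(A.LFunction q : PadicAlgCl 2) - (W.LFunction q : PadicAlgCl 2)‖ < 1)
    (S₀ : Finset (IsDedekindDomain.HeightOneSpectrum (NumberField.RingOfIntegers ℚ)))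
    (hS2 : ∀ v ∈ S₀, ((2 : ℕ) : NumberField.RingOfIntegers ℚ) ∉ v.asIdeal)
    (hSW : ∀ v : IsDedekindDomain.HeightOneSpectrum (NumberField.RingOfIntegers ℚ), ¬ W.HasGoodReductionAt v → v ∈ S₀)
    (hSA : ∀ v : IsDedekindDomain.HeightOneSpectrum (NumberField.RingOfIntegers ℚ), ¬ A.HasGoodReductionAt v → v ∈ S₀)
    (ϖ ϖA : ℚ)
    (hμW : ∃ x₀ : ℚ, (∀ r : ℚ, ‖(∑ k ∈ Fintype.piFinset (fun _ : S₀ ↦ Finset.range 3), (∏ v : S₀, ((W.localPolynomialAt (v : IsDedekindDomain.HeightOneSpectrum (NumberField.RingOfIntegers ℚ))).map (Int.castRingHom (PadicAlgCl 2))).coeff (k v) * ((Rat.HeightOneSpectrum.natGenerator (v : IsDedekindDomain.HeightOneSpectrum (NumberField.RingOfIntegers ℚ)) : PadicAlgCl 2)⁻¹) ^ (k v)) * algebraMap ℚ (PadicAlgCl 2) (ratPlusSymbol f (r * ((∏ v : S₀, Rat.HeightOneSpectrum.natGenerator (v : IsDedekindDomain.HeightOneSpectrum (NumberField.RingOfIntegers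 ℚ)) ^ (k v) : ℕ) : ℚ))))‖ ≤ ‖(∑ k ∈ Fintype.piFinset (fun _ : S₀ ↦ Finset.range 3), (∏ v : S₀, ((W.localPolynomialAt (v : IsDedekindDomain.HeightOneSpectrum (NumberField.RingOfIntegers ℚ))).map (Int.castRingHom (PadicAlgCl 2))).coeff (k v) * ((Rat.HeightOneSpectrum.natGenerator (v : IsDedekindDomain.HeightOneSpectrum (NumberField.RingOfIntegers ℚ)) : PadicAlgCl 2)⁻¹) ^ (k v)) * algebraMap ℚ (PadicAlgCl 2) (ratPlusSymbol f (x₀ * ((∏ v : S₀, Rat.HeightOneSpectrum.natGenerator (v : IsDedekindDomain.HeightOneSpectrum (NumberField.RingOfIntegers ℚ)) ^ (k v) : ℕ) : ℚ))))‖) ∧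
      ‖algebraMap ℚ (PadicAlgCl 2) (2 * ϖ) * (∑ k ∈ Fintype.piFinset (fun _ : S₀ ↦ Finset.range 3), (∏ v : S₀, ((W.localPolynomialAt (v : IsDedekindDomain.HeightOneSpectrum (NumberField.RingOfIntegers ℚ))).map (Int.castRingHom (PadicAlgCl 2))).coeff (k v) * ((Rat.HeightOneSpectrum.natGenerator (v : IsDedekindDomain.HeightOneSpectrum (NumberField.RingOfIntegers ℚ)) : PadicAlgCl 2)⁻¹) ^ (k v)) * algebraMap ℚ (PadicAlgCl 2) (ratPlusSymbol f (x₀ * ((∏ v : S₀, Rat.HeightOneSpectrum.natGenerator (v : IsDedekindDomain.HeightOneSpectrum (NumberField.RingOfIntegers ℚ)) ^ (k v) : ℕ) : ℚ))))‖ = 1)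
    (hμA : ∃ x₀ : ℚ, (∀ r : ℚ, ‖(∑ k ∈ Fintype.piFinset (fun _ : S₀ ↦ Finset.range 3), (∏ v : S₀, ((A.localPolynomialAt (v : IsDedekindDomain.HeightOneSpectrum (NumberField.RingOfIntegers ℚ))).map (Int.castRingHom (PadicAlgCl 2))).coeff (k v) * ((Rat.HeightOneSpectrum.natGenerator (v : IsDedekindDomain.HeightOneSpectrum (NumberField.RingOfIntegers ℚ)) : PadicAlgCl 2)⁻¹) ^ (k v)) * algebraMap ℚ (PadicAlgCl 2) (ratPlusSymbol fA (r * ((∏ v : S₀, Rat.HeightOneSpectrum.natGenerator (v : IsDedekindDomain.HeightOneSpectrum (NumberField.RingOfIntegers ℚ)) ^ (k v) : ℕ) : ℚ))))‖ ≤ ‖(∑ k ∈ Fintype.piFinset (fun _ : S₀ ↦ Finset.range 3), (∏ v : S₀, ((A.localPolynomialAt (v : IsDedekindDomain.HeightOneSpectrum (NumberField.RingOfIntegers ℚ))).map (Int.castRingHom (PadicAlgCl 2))).coeff (k v) * ((Rat.HeightOneSpectrum.natGenerator (v : IsDedekindDomain.HeightOneSpectrum (NumberField.RingOfIntegers ℚ))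 : PadicAlgCl 2)⁻¹) ^ (k v)) * algebraMap ℚ (PadicAlgCl 2) (ratPlusSymbol fA (x₀ * ((∏ v : S₀, Rat.HeightOneSpectrum.natGenerator (v : IsDedekindDomain.HeightOneSpectrum (NumberField.RingOfIntegers ℚ)) ^ (k v) : ℕ) : ℚ))))‖) ∧
      ‖algebraMap ℚ (PadicAlgCl 2) (2 * ϖA) * (∑ k ∈ Fintype.piFinset (fun _ : S₀ ↦ Finset.range 3), (∏ v : S₀, ((A.localPolynomialAt (v : IsDedekindDomain.HeightOneSpectrum (NumberField.RingOfIntegers ℚ))).map (Int.castRingHom (PadicAlgCl 2))).coeff (k v) * ((Rat.HeightOneSpectrum.natGenerator (v : IsDedekindDomain.HeightOneSpectrum (NumberField.RingOfIntegers ℚ)) : PadicAlgCl 2)⁻¹) ^ (k v)) * algebraMap ℚ (PadicAlgCl 2) (ratPlusSymbol fA (x₀ * ((∏ v : S₀, Rat.HeightOneSpectrum.natGenerator (v : IsDedekindDomain.HeightOneSpectrum (NumberField.RingOfIntegers ℚ)) ^ (k v) : ℕ) : ℚ))))‖ = 1)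
    (n a : ℕ) (ha : Odd a) :
    ‖((2 * ϖ * eulerDepleteTableList W S₀.toList (ratPlusSymbol f) ((a : ℚ) / (2 : ℚ) ^ (n + 2)) : ℚ) : ℚ_[2]) -
        ((2 * ϖA * eulerDepleteTableList A S₀.toList (ratPlusSymbol fA) ((a : ℚ) / (2 : ℚ) ^ (n + 2)) : ℚ) : ℚ_[2])‖ ≤ ‖(2 : ℚ_[2])‖ := by
  have hAodd : Odd (A.conductorNorm ℤ) := by
    have h2A : ¬ 2 ∣ A.conductorNorm ℤ := by
      rw [A.dvd_conductorNorm_iff_not_hasGoodReductionAtPrime 2, not_not]; exact hssA.1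
    exact Nat.odd_iff.mpr (Nat.two_dvd_ne_zero.mp h2A)
  -- the odd numerator `a` is `± 5^F (mod 2^{n+2})`: move to the cusp `5^{s₀}/2^{n+2}`
  have ha2 : ¬ 2 ∣ a := fun h ↦ (Nat.not_even_iff_odd.mpr ha) (even_iff_two_dvd.mpr h)
  obtain ⟨ω, hω, haω⟩ := exists_sign_mul_cyclotomicGenerator_pow_eq ha2 n
  set F₀ : ℕ := (PadicInt.toZModPow n (frobeniusExponent 2 (a : ℤ_[2]))).val with hF₀
  set s₀ : ZMod (2 ^ n) := (F₀ : ZMod (2 ^ n)) with hs₀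
  have hs₀v : s₀.val = F₀ % 2 ^ n := ZMod.val_natCast (2 ^ n) F₀
  haveI : Fact (1 < 2 ^ (n + 2)) := ⟨Nat.one_lt_two_pow (by omega)⟩
  have hxa : ∀ ψ : ℚ → ℚ, (∀ x, ψ (-x) = ψ x) → (∀ (x : ℚ) (z : ℤ), ψ (x + z) = ψ x) →
      ψ ((a : ℚ) / (2 : ℚ) ^ (n + 2)) = ψ ((((cyclotomicGenerator 2 : ZMod (2 ^ (n + 2))) ^ s₀.val).val : ℚ) / (2 : ℚ) ^ (n + 2)) := by
    intro ψ hneg hper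
    have h := apply_mul_cyclotomicGenerator_pow_val_div ψ hneg hper hω haω 0
    rw [pow_zero, ZMod.val_one, zero_add, Nat.cast_one, ← mul_div_assoc, mul_one] at h
    rw [h, hs₀v, ← cyclotomicGenerator_two_pow_eq_pow_mod]
  have hlW := hxa _ (eulerDepleteTableList_neg W S₀.toList (ratPlusSymbol_neg f))
    (eulerDepleteTableList_add_intCast' W S₀.toList (ratPlusSymbol_add_intCast_eq f))
  have hlA := hxa _ (eulerDepleteTableList_neg A S₀.toList (ratPlusSymbol_neg fA))
    (eulerDepleteTableList_add_intCast' A S₀.toList (ratPlusSymbol_add_intCast_eq fA))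
  rw [hlW, hlA, ← expandedTable_cusp_eq_eulerDepleteTableList W f S₀ hS2 n s₀,
    ← expandedTable_cusp_eq_eulerDepleteTableList A fA S₀ hS2 n s₀]
  -- the bridge at `r = 5^{s₀}/2^{n+2}`, read through `ℚ → ℚ₂ → ℚ̄₂`
  have hB := depletedParity_of_congruent_of_facts_anyRank hES hF hMK hSD hBz hSe hss hΔ hf hAodd hfA hcong S₀ hS2 hSW hSA
    ϖ ϖA hμW hμA ((((cyclotomicGenerator 2 : ZMod (2 ^ (n + 2))) ^ s₀.val).val : ℚ) / (2 : ℚ) ^ (n + 2))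
  rw [expandedTable_eq_algebraMap W f S₀ (PadicAlgCl 2), expandedTable_eq_algebraMap A fA S₀ (PadicAlgCl 2),
    ← map_mul, ← map_mul, ← map_sub] at hB
  have hcastq : ∀ q : ℚ, algebraMap ℚ (PadicAlgCl 2) q = algebraMap ℚ_[2] (PadicAlgCl 2) (q : ℚ_[2]) := by
    intro q; rw [map_ratCast, eq_ratCast]
  rw [hcastq, PadicAlgCl.norm_extends (p := 2)] at hB
  push_cast at hB ⊢
  -- a `ℚ₂`-norm `< 1` is `≤ ‖2‖`
  have h := (Padic.norm_le_pow_iff_norm_lt_pow_add_one _ (-1)).mpr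
    (by rw [show (-1 : ℤ) + 1 = 0 from by norm_num, zpow_zero]; exact hB)
  have h2n : ‖(2 : ℚ_[2])‖ = (2 : ℝ)⁻¹ := by
    have h' := Padic.norm_p (p := 2); exact_mod_cast h'
  have h3 : ((2 : ℕ) : ℝ) ^ (-1 : ℤ) = (2 : ℝ)⁻¹ := by norm_num
  rw [h2n, ← h3]
  convert h using 2

end Cusps

section Assembly

variable (W : WeierstrassCurve ℚ) [W.IsElliptic] [W.IsGloballyMinimal] (A : WeierstrassCurve ℚ) [A.IsElliptic]
  [A.IsGloballyMinimal]

/-- **One-socket assembly (line `symbol`, crux 25797 = 21416, EVERY PARTNER).** Granted the six named facts of the plus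
line, for `W` good supersingular at `2` with `Δ_W < 0`, a partner `A` good supersingular at `2` (any analytic ranks) with a
Galois-equivariant `W[2] ≃+ A[2]`, newforms `f, f_A` with Pollack pairs at `2`, an admissible `S₀` (odd places
containing the bad places of both), rationals `ϖ, ϖ_A` satisfying `μ⁎(W)`, `μ⁎(A)` (unit value of the doubled expanded depleted
table at a point of maximal absolute value), and integral multiples `ι G = 2^m ϖ ι L♭`, `ι G_A = 2^{m'} ϖ_A ι L♭_A`: the
conclusion of `MazurTateCongruenceAtTwoR` holds, with `u = 1` — trace congruence from `W[2] ≃ A[2]` (`…RTraceParity`), (PAR2) at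
the cusps from the plus line (`…ROfPlusLineList`), `u = 1` symbol bound (§2), per-layer reduction (§1).
[cite: GreenbergVatsal2000, Thm. (1.4), §3 (13)] [cite: Vatsal1999, Thm. (1.13)] [cite: Buzzard2000LevelLoweringModTwo, Prop. 2.4]
[cite: DarmonDiamondTaylor1995, Prop. 2.11 (a)] -/
theorem mazurTateCongruence_of_facts
    (hES : eichlerShimura_depletedOptimalQuotient_periodLattice_of_dvd)
    (hF : WeierstrassCurve.isIsogenous_iff_frobeniusTrace_eq) (hMK : mazurKenku_exists_cyclic_isogeny)
    (hSD : heckeSelfDual_torsionBy_J0) (hBz : buzzard2000_multiplicityOne_gamma0)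
    (hSe : serre1972_supersingular_decompositionSubgroup_image)
    (hss : GoodSS W 2) (hΔ : W.Δ < 0) (hssA : GoodSS A 2)
    (he : ∃ e : geomTorsion W (2 : ℤ) ≃+ geomTorsion A (2 : ℤ),
      ∀ (σ : Field.absoluteGaloisGroup ℚ) (P : geomTorsion W (2 : ℤ)), e (σ • P) = σ • e P)
    [NeZero (W.conductorNorm ℤ)] (f : CuspForm (Gamma0 (W.conductorNorm ℤ)) 2) (hf : IsNewformOf W f) (ϖ : ℚ)
    {Lplus Lminus : IwasawaAlgebra 2} (hPP : IsPollackPair f 2 Lplus Lminus)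
    [NeZero (A.conductorNorm ℤ)] (fA : CuspForm (Gamma0 (A.conductorNorm ℤ)) 2) (hfA : IsNewformOf A fA) (ϖA : ℚ)
    {LplusA LminusA : IwasawaAlgebra 2} (hPPA : IsPollackPair fA 2 LplusA LminusA)
    (S₀ : Finset (HeightOneSpectrum (𝓞 ℚ))) (hS2 : ∀ v ∈ S₀, ((2 : ℕ) : 𝓞 ℚ) ∉ v.asIdeal)
    (hSW : ∀ v : HeightOneSpectrum (𝓞 ℚ), ¬ W.HasGoodReductionAt v → v ∈ S₀)
    (hSA : ∀ v : HeightOneSpectrum (𝓞 ℚ), ¬ A.HasGoodReductionAt v → v ∈ S₀)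
    (hμW : (∃ x₀ : ℚ, (∀ r : ℚ, ‖(∑ k ∈ Fintype.piFinset (fun _ : S₀ ↦ Finset.range 3), (∏ v : S₀, ((W.localPolynomialAt (v : HeightOneSpectrum (𝓞 ℚ))).map (Int.castRingHom (PadicAlgCl 2))).coeff (k v) * ((Rat.HeightOneSpectrum.natGenerator (v : HeightOneSpectrum (𝓞 ℚ)) : PadicAlgCl 2)⁻¹) ^ (k v)) * algebraMap ℚ (PadicAlgCl 2) (ratPlusSymbol f (r * ((∏ v : S₀, Rat.HeightOneSpectrum.natGenerator (v : HeightOneSpectrum (𝓞 ℚ)) ^ (k v) : ℕ) : ℚ))))‖ ≤ ‖(∑ k ∈ Fintype.piFinset (fun _ : S₀ ↦ Finset.range 3), (∏ v : S₀, ((W.localPolynomialAt (v : HeightOneSpectrum (𝓞 ℚ))).map (Int.castRingHom (PadicAlgCl 2))).coeff (k v) * ((Rat.HeightOneSpectrum.natGenerator (v : HeightOneSpectrum (𝓞 ℚ)) : PadicAlgCl 2)⁻¹) ^ (k v)) * algebraMap ℚ (PadicAlgCl 2) (ratPlusSymbol f (x₀ * ((∏ v : S₀, Rat.HeightOneSpectrum.natGenerator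 (v : HeightOneSpectrum (𝓞 ℚ)) ^ (k v) : ℕ) : ℚ))))‖) ∧
      ‖algebraMap ℚ (PadicAlgCl 2) (2 * ϖ) * (∑ k ∈ Fintype.piFinset (fun _ : S₀ ↦ Finset.range 3), (∏ v : S₀, ((W.localPolynomialAt (v : HeightOneSpectrum (𝓞 ℚ))).map (Int.castRingHom (PadicAlgCl 2))).coeff (k v) * ((Rat.HeightOneSpectrum.natGenerator (v : HeightOneSpectrum (𝓞 ℚ)) : PadicAlgCl 2)⁻¹) ^ (k v)) * algebraMap ℚ (PadicAlgCl 2) (ratPlusSymbol f (x₀ * ((∏ v : S₀, Rat.HeightOneSpectrum.natGenerator (v : HeightOneSpectrum (𝓞 ℚ)) ^ (k v) : ℕ) : ℚ))))‖ = 1))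
    (hμA : (∃ x₀ : ℚ, (∀ r : ℚ, ‖(∑ k ∈ Fintype.piFinset (fun _ : S₀ ↦ Finset.range 3), (∏ v : S₀, ((A.localPolynomialAt (v : HeightOneSpectrum (𝓞 ℚ))).map (Int.castRingHom (PadicAlgCl 2))).coeff (k v) * ((Rat.HeightOneSpectrum.natGenerator (v : HeightOneSpectrum (𝓞 ℚ)) : PadicAlgCl 2)⁻¹) ^ (k v)) * algebraMap ℚ (PadicAlgCl 2) (ratPlusSymbol fA (r * ((∏ v : S₀, Rat.HeightOneSpectrum.natGenerator (v : HeightOneSpectrum (𝓞 ℚ)) ^ (k v) : ℕ) : ℚ))))‖ ≤ ‖(∑ k ∈ Fintype.piFinset (fun _ : S₀ ↦ Finset.range 3), (∏ v : S₀, ((A.localPolynomialAt (v : HeightOneSpectrum (𝓞 ℚ))).map (Int.castRingHom (PadicAlgCl 2))).coeff (k v) * ((Rat.HeightOneSpectrum.natGenerator (v : HeightOneSpectrum (𝓞 ℚ)) : PadicAlgCl 2)⁻¹) ^ (k v)) * algebraMap ℚ (PadicAlgCl 2) (ratPlusSymbol fA (x₀ * ((∏ v : S₀, Rat.HeightOneSpectrum.natGenerator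 (v : HeightOneSpectrum (𝓞 ℚ)) ^ (k v) : ℕ) : ℚ))))‖) ∧
      ‖algebraMap ℚ (PadicAlgCl 2) (2 * ϖA) * (∑ k ∈ Fintype.piFinset (fun _ : S₀ ↦ Finset.range 3), (∏ v : S₀, ((A.localPolynomialAt (v : HeightOneSpectrum (𝓞 ℚ))).map (Int.castRingHom (PadicAlgCl 2))).coeff (k v) * ((Rat.HeightOneSpectrum.natGenerator (v : HeightOneSpectrum (𝓞 ℚ)) : PadicAlgCl 2)⁻¹) ^ (k v)) * algebraMap ℚ (PadicAlgCl 2) (ratPlusSymbol fA (x₀ * ((∏ v : S₀, Rat.HeightOneSpectrum.natGenerator (v : HeightOneSpectrum (𝓞 ℚ)) ^ (k v) : ℕ) : ℚ))))‖ = 1))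
    {G GA : IwasawaAlgebra 2} {m m' : ℕ}
    (hG : iwasawaToPowerSeries 2 G =
      PowerSeries.C ((2 : ℚ_[2]) ^ m * (ϖ : ℚ_[2])) * iwasawaToPowerSeries 2 (kobayashiL 1 Lplus Lminus))
    (hGA : iwasawaToPowerSeries 2 GA =
      PowerSeries.C ((2 : ℚ_[2]) ^ m' * (ϖA : ℚ_[2])) * iwasawaToPowerSeries 2 (kobayashiL 1 LplusA LminusA)) :
    ∃ u : ℤ_[2]ˣ, ∀ n : ℕ, Even n → ∃ q r : IwasawaAlgebra 2,
      PowerSeries.C (((2 : ℤ_[2]) ^ m' : ℤ_[2]) : ℚ_[2]) *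
            (PowerSeries.C ((2 : ℚ_[2]) ^ m * (ϖ : ℚ_[2])) *
              ((mazurTateElement f 2 n).map (algebraMap ℚ ℚ_[2]) : PowerSeries ℚ_[2]) *
              iwasawaToPowerSeries 2 (eulerFactorProductInv W 2 S₀)) -
          PowerSeries.C (((u : ℤ_[2]) * (2 : ℤ_[2]) ^ m : ℤ_[2]) : ℚ_[2]) *
            (PowerSeries.C ((2 : ℚ_[2]) ^ m' * (ϖA : ℚ_[2])) *
              ((mazurTateElement fA 2 n).map (algebraMap ℚ ℚ_[2]) : PowerSeries ℚ_[2]) *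
              iwasawaToPowerSeries 2 (eulerFactorProductInv A 2 S₀)) =
        iwasawaToPowerSeries 2 (PowerSeries.C ((2 : ℤ_[2]) ^ (m + m' + 1)) * q + Sprung2017.toIwasawa 2 (cyclotomicOmega 2 n) * r) := by
  obtain ⟨e, he'⟩ := he
  have hcong : ∀ q : ℕ, q.Prime → ¬ q ∣ W.conductorNorm ℤ → ¬ q ∣ A.conductorNorm ℤ →
      ‖(A.LFunction q : PadicAlgCl 2) - (W.LFunction q : PadicAlgCl 2)‖ < 1 :=
    fun q hq hW hA ↦ norm_LFunction_sub_lt_one_of_equiv W A e he' hss hssA hq hW hA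
  refine ⟨1, fun n hn ↦ layerCongruence_of_symbolBound W A f fA hPP hPPA hG hGA S₀ hS2 1 hn fun a ha ↦ ?_⟩
  exact norm_sub_le_one_of_parity _ _ _ _ (parity_cusps_of_congruent_of_facts_anyRank hES hF hMK hSD hBz hSe hss hΔ hf hssA
    hfA hcong S₀ hS2 hSW hSA ϖ ϖA hμW hμA n a ha)

end Assembly

/-! ## §4. The crux BY NAME from the six facts, the habitat lemma and the symbol-`μ` statement -/

/-- **`MazurTateCongruenceAtTwoTop` (crux 25797; `= MazurTateCongruenceAtTwoR`, 21416) FROM NAMED HYPOTHESES.** Granted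
(i) the six named facts of the plus line (Eichler–Shimura depleted optimal quotient, Faltings, Mazur–Kenku, Hecke self-duality,
Buzzard's mod-`2` multiplicity one, Serre 1972), (ii) the habitat lemma `HΔ`: on the theta habitat (`A` CM, both good supersingular
at `2` with `a₂ = 0`, `W[2] ≃ A[2]` equivariantly) `Δ_W < 0`, and (iii) the symbol-`μ` statement `Hμ` at `2`: for every globally
minimal elliptic `E` good supersingular at `2` with `a₂(E) = 0`, newform `f`, Néron ratio `ϖ` and admissible `S₀`, the expanded
`S₀`-depleted plus table attains its maximal `2`-adic size at a point `x₀` where `‖2ϖΨ(x₀)‖ = 1` — the crux holds (with `u = 1`).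
[cite: GreenbergVatsal2000, Thm. (1.4), §3 (13)] [cite: Vatsal1999, Thm. (1.13)] [cite: Buzzard2000LevelLoweringModTwo, Prop. 2.4] -/
theorem mazurTateCongruenceAtTwoTop_of_facts
    (hES : eichlerShimura_depletedOptimalQuotient_periodLattice_of_dvd)
    (hF : WeierstrassCurve.isIsogenous_iff_frobeniusTrace_eq) (hMK : mazurKenku_exists_cyclic_isogeny)
    (hSD : heckeSelfDual_torsionBy_J0) (hBz : buzzard2000_multiplicityOne_gamma0)
    (hSe : serre1972_supersingular_decompositionSubgroup_image)
    (HΔ : ∀ (W : WeierstrassCurve ℚ) [W.IsElliptic] [W.IsGloballyMinimal] (A : WeierstrassCurve ℚ) [A.IsElliptic]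
      [A.IsGloballyMinimal], ¬ W.HasCM → W.analyticRank = 0 → GoodSS W 2 → W.frobeniusTrace 2 = 0 → A.HasCM → GoodSS A 2 →
      A.frobeniusTrace 2 = 0 →
      (∃ e : geomTorsion W (2 : ℤ) ≃+ geomTorsion A (2 : ℤ),
        ∀ (σ : Field.absoluteGaloisGroup ℚ) (P : geomTorsion W (2 : ℤ)), e (σ • P) = σ • e P) → W.Δ < 0)
    (Hμ : ∀ (E : WeierstrassCurve ℚ) [E.IsElliptic] [E.IsGloballyMinimal], GoodSS E 2 → E.frobeniusTrace 2 = 0 →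
      ∀ [NeZero (E.conductorNorm ℤ)] (f : CuspForm (Gamma0 (E.conductorNorm ℤ)) 2), IsNewformOf E f →
      ∀ (ϖ : ℚ), (ϖ : ℝ) * E.realPeriodRat = plusPeriod f →
      ∀ (S₀ : Finset (HeightOneSpectrum (𝓞 ℚ))), (∀ v ∈ S₀, ((2 : ℕ) : 𝓞 ℚ) ∉ v.asIdeal) →
        (∀ v : HeightOneSpectrum (𝓞 ℚ), ¬ E.HasGoodReductionAt v → v ∈ S₀) →
      ∃ x₀ : ℚ, (∀ r : ℚ, ‖(∑ k ∈ Fintype.piFinset (fun _ : S₀ ↦ Finset.range 3), (∏ v : S₀, ((E.localPolynomialAt (v : HeightOneSpectrum (𝓞 ℚ))).map (Int.castRingHom (PadicAlgCl 2))).coeff (k v) * ((Rat.HeightOneSpectrum.natGenerator (v : HeightOneSpectrum (𝓞 ℚ)) : PadicAlgCl 2)⁻¹) ^ (k v)) * algebraMap ℚ (PadicAlgCl 2) (ratPlusSymbol f (r * ((∏ v : S₀, Rat.HeightOneSpectrum.natGenerator (v : HeightOneSpectrum (𝓞 ℚ)) ^ (k v) : ℕ) : ℚ))))‖ ≤ ‖(∑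 k ∈ Fintype.piFinset (fun _ : S₀ ↦ Finset.range 3), (∏ v : S₀, ((E.localPolynomialAt (v : HeightOneSpectrum (𝓞 ℚ))).map (Int.castRingHom (PadicAlgCl 2))).coeff (k v) * ((Rat.HeightOneSpectrum.natGenerator (v : HeightOneSpectrum (𝓞 ℚ)) : PadicAlgCl 2)⁻¹) ^ (k v)) * algebraMap ℚ (PadicAlgCl 2) (ratPlusSymbol f (x₀ * ((∏ v : S₀, Rat.HeightOneSpectrum.natGenerator (v : HeightOneSpectrum (𝓞 ℚ)) ^ (k v) : ℕ) : ℚ))))‖) ∧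
        ‖algebraMap ℚ (PadicAlgCl 2) (2 * ϖ) * (∑ k ∈ Fintype.piFinset (fun _ : S₀ ↦ Finset.range 3), (∏ v : S₀, ((E.localPolynomialAt (v : HeightOneSpectrum (𝓞 ℚ))).map (Int.castRingHom (PadicAlgCl 2))).coeff (k v) * ((Rat.HeightOneSpectrum.natGenerator (v : HeightOneSpectrum (𝓞 ℚ)) : PadicAlgCl 2)⁻¹) ^ (k v)) * algebraMap ℚ (PadicAlgCl 2) (ratPlusSymbol f (x₀ * ((∏ v : S₀, Rat.HeightOneSpectrum.natGenerator (v : HeightOneSpectrum (𝓞 ℚ)) ^ (k v) : ℕ) : ℚ))))‖ = 1) :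
    Summit.BirchSwinnertonDyer.BirchSwinnertonDyer.Theses.ThetaPartnerAtTwo.MazurTateCongruenceAtTwoTop := by
  intro W _ _ A _ _ hcm hr hss ha hAcm hAss hAa he γ _hγ _ f hf ϖ hϖ Lplus Lminus hPP _ fA hfA ϖA hϖA LplusA LminusA hPPA
    S₀ hS2 hSW hSA G m hG GA m' hGA
  exact mazurTateCongruence_of_facts W A hES hF hMK hSD hBz hSe hss (HΔ W A hcm hr hss ha hAcm hAss hAa he) hAss he f hf ϖ
    hPP fA hfA ϖA hPPA S₀ hS2 hSW hSA (Hμ W hss ha f hf ϖ hϖ S₀ hS2 hSW) (Hμ A hAss hAa fA hfA ϖA hϖA S₀ hS2 hSA) hG hGA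

/-- The same, concluded as `MazurTateCongruenceAtTwoR` (stmt-21416) by name. [cite: GreenbergVatsal2000, Thm. (1.4), §3 (13)] -/
theorem mazurTateCongruenceAtTwoR_of_facts
    (hES : eichlerShimura_depletedOptimalQuotient_periodLattice_of_dvd)
    (hF : WeierstrassCurve.isIsogenous_iff_frobeniusTrace_eq) (hMK : mazurKenku_exists_cyclic_isogeny)
    (hSD : heckeSelfDual_torsionBy_J0) (hBz : buzzard2000_multiplicityOne_gamma0)
    (hSe : serre1972_supersingular_decompositionSubgroup_image)
    (HΔ : ∀ (W : WeierstrassCurve ℚ) [W.IsElliptic] [W.IsGloballyMinimal] (A : WeierstrassCurve ℚ) [A.IsElliptic]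
      [A.IsGloballyMinimal], ¬ W.HasCM → W.analyticRank = 0 → GoodSS W 2 → W.frobeniusTrace 2 = 0 → A.HasCM → GoodSS A 2 →
      A.frobeniusTrace 2 = 0 →
      (∃ e : geomTorsion W (2 : ℤ) ≃+ geomTorsion A (2 : ℤ),
        ∀ (σ : Field.absoluteGaloisGroup ℚ) (P : geomTorsion W (2 : ℤ)), e (σ • P) = σ • e P) → W.Δ < 0)
    (Hμ : ∀ (E : WeierstrassCurve ℚ) [E.IsElliptic] [E.IsGloballyMinimal], GoodSS E 2 → E.frobeniusTrace 2 = 0 →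
      ∀ [NeZero (E.conductorNorm ℤ)] (f : CuspForm (Gamma0 (E.conductorNorm ℤ)) 2), IsNewformOf E f →
      ∀ (ϖ : ℚ), (ϖ : ℝ) * E.realPeriodRat = plusPeriod f →
      ∀ (S₀ : Finset (HeightOneSpectrum (𝓞 ℚ))), (∀ v ∈ S₀, ((2 : ℕ) : 𝓞 ℚ) ∉ v.asIdeal) →
        (∀ v : HeightOneSpectrum (𝓞 ℚ), ¬ E.HasGoodReductionAt v → v ∈ S₀) →
      ∃ x₀ : ℚ, (∀ r : ℚ, ‖(∑ k ∈ Fintype.piFinset (fun _ : S₀ ↦ Finset.range 3), (∏ v : S₀, ((E.localPolynomialAt (v : HeightOneSpectrum (𝓞 ℚ))).map (Int.castRingHom (PadicAlgCl 2))).coeff (k v) * ((Rat.HeightOneSpectrum.natGenerator (v : HeightOneSpectrum (𝓞 ℚ)) : PadicAlgCl 2)⁻¹) ^ (k v)) * algebraMap ℚ (PadicAlgCl 2) (ratPlusSymbol f (r * ((∏ v : S₀, Rat.HeightOneSpectrum.natGenerator (v : HeightOneSpectrum (𝓞 ℚ)) ^ (k v) : ℕ) : ℚ))))‖ ≤ ‖(∑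 k ∈ Fintype.piFinset (fun _ : S₀ ↦ Finset.range 3), (∏ v : S₀, ((E.localPolynomialAt (v : HeightOneSpectrum (𝓞 ℚ))).map (Int.castRingHom (PadicAlgCl 2))).coeff (k v) * ((Rat.HeightOneSpectrum.natGenerator (v : HeightOneSpectrum (𝓞 ℚ)) : PadicAlgCl 2)⁻¹) ^ (k v)) * algebraMap ℚ (PadicAlgCl 2) (ratPlusSymbol f (x₀ * ((∏ v : S₀, Rat.HeightOneSpectrum.natGenerator (v : HeightOneSpectrum (𝓞 ℚ)) ^ (k v) : ℕ) : ℚ))))‖) ∧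
        ‖algebraMap ℚ (PadicAlgCl 2) (2 * ϖ) * (∑ k ∈ Fintype.piFinset (fun _ : S₀ ↦ Finset.range 3), (∏ v : S₀, ((E.localPolynomialAt (v : HeightOneSpectrum (𝓞 ℚ))).map (Int.castRingHom (PadicAlgCl 2))).coeff (k v) * ((Rat.HeightOneSpectrum.natGenerator (v : HeightOneSpectrum (𝓞 ℚ)) : PadicAlgCl 2)⁻¹) ^ (k v)) * algebraMap ℚ (PadicAlgCl 2) (ratPlusSymbol f (x₀ * ((∏ v : S₀, Rat.HeightOneSpectrum.natGenerator (v : HeightOneSpectrum (𝓞 ℚ)) ^ (k v) : ℕ) : ℚ))))‖ = 1) :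
    Summit.BirchSwinnertonDyer.BirchSwinnertonDyer.Theses.ThetaPartnerAtTwo.MazurTateCongruenceAtTwoR :=
  mazurTateCongruenceAtTwoTop_of_facts hES hF hMK hSD hBz hSe HΔ Hμ


end Summit.BirchSwinnertonDyer.BirchSwinnertonDyer.Theorems.MazurTateCongruenceAtTwoR

end
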